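import Summits.AtomisticToContinuum.Crystallization.Theorems.FrustratedLawDichotomyStrainedPatchStrainBands

/-!
# [CORE-FAR] in DIVERGENCE FORM: host-free site laws after ONE antisymmetric flux RULE, rim allowance, class count («FluxLocal», lens-5 g59)

Lens-5 («finite / base range + asymptotic regime + bridge») REDESIGN node on the 27623 T-side piece `StrainedPatchRec` after OUTER30
(critic ROWS 1063 / 1066: the LP-dual / IFT binders of 56K–57Q are DEAD-AS-DESIGNED; exit (X3b) LOCALISATION first, HOST-FREE variant first,
typed against the census's flux-feasibility LP (O8); the graded-chart frame 58G (`…GradedCharts`, (ENVᵍ)/(ROOMᵍ)/(CERTᵍ)) is the fallback and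
its tolerance profile `τ` stays UNPINNED).  TARGET OF RECORD, verbatim: `CoreOffTubeFloor (63/10) (63/10) (24/5) (1/100) 0` **[CORE-FAR]**.

THE OBJECT.  Write the score in the SENDER-NORMALISED currency it is defined in, `S(z,c) = Σ_{j ∈ B} s_j`, `B = ball (9/5) z c`,
`s_j := xRec_j / #ball (9/5) z j` (`share`; a LOCAL site functional: partners of `j` within the range of `W` and `9/5`).  A FLUX RULE is ONE function
`F : (M : ℕ) → (Fin M → E3) → Fin M → Fin M → ℝ` — it reads the cluster and two sites, NO host, NO chart, NO centre — asked to be antisymmetric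
(`RuleAntisym`; range and flux bound are the sequel's interface).
KERNEL (§1, proved): for antisymmetric `f`, `Σ_{j∈B} Σ_{k∈B} f j k = 0` and `Σ_{j∈B} div f j = Σ_{j∈B} Σ_{k∉B} f j k` (telescoping: only RIM bonds
survive); hence `φ ≤ S(z,c)` from a per-member floor after the flux and a bound on the rim exchange.  COSTUME CERTIFICATE (§1, proved both ways, the tree's
`…LocalPricing` dictionary cut down to one ball): for ONE cluster, «∃ antisymmetric member-to-member transfers after which every member clears `γ_j`» ⟺
`Σ_B γ ≤ S` — cluster-dependent fluxes add NOTHING; all content of (X3b) is that `F` is ONE RULE for every cluster (+ range + bound), which is what makes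
each law below a statement about ONE SITE'S MOTIF instead of a 4 200-dimensional host box (row 1063: margins of `S_hom = 3.5·10⁻³` at relative precision `10⁻⁷`
cannot be won globally).

THE PIECES (§2; every law quantifies over a CLUSTER CLASS `H M z c` — for the record `FarClass r r₁ ρ ε` = admissible ∧ clean ∧ mono-phase ∧ far):
* (X3b-S) `SiteLaw H F γ` [ANALYTIC per site class · UNDECIDED · INSTRUMENTABLE by (O8′)] — every `9/5`-member `j` of an `H`-cluster clears its floor
  AFTER the rule's net inflow: `γ(z,j) ≤ s_j + Σ_k F z j k`.  Pure site law: the floor `γ` reads `(M, z, j)` only; SITE CLASSES enter as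
  `γ = g ∘ κ` for a classifier `κ` (`siteLaw_iff_classLaws`: the law IS the conjunction of the per-class laws `ClassSiteLaw H F κ g a`, one CERT piece per
  class `a`) — and THIS is the only door through which a tolerance profile / local chart enters (e.g. `κ j` = «`j`'s `R`-motif is `τ(R)`-charted by some
  lattice instance», quantifier INSIDE the class predicate, host-free).
* (X3b-R) `RimLaw H F β` [GEOMETRIC-ANALYTIC · WEAKER · INSTRUMENTABLE] — a member's exchange with NON-members is at most its rim allowance `β(z,c,j)`
  (sequel `…FluxLocalRules`, `rimLaw_of_fluxBound`: it FOLLOWS from a bond-length flux bound `FluxBound F Φ` ((O8)'s `|flux| ≤ Φ`) + finite range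
  `HasRange F L` + the purely geometric RIM-CAPACITY count `Σ_{k ∉ B, r_jk ≤ L} Φ(r_jk) ≤ β` per member class).
* (X3b-C) `CountLaw H γ β φ` [COMBINATORIAL · WEAKER · DECIDABLE per cluster] — floors beat rim allowances by `φ` on every `H`-ball: `φ ≤ Σ_{j∈B} (γ_j − β_j)`;
  `countLaw_of_histogramLaw`: with classed floors/allowances it is a CLASS-HISTOGRAM constraint on far balls (`ClassHistogramLaw`) + one linear inequality.
* JUNCTION (proved, every `H F γ β φ`): `ballFloor_of_site_of_rim_of_count : RuleAntisym F → SiteLaw H F γ → RimLaw H F β → CountLaw H γ β φ → BallFloor H φ`,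
  `coreOffTubeFloor_iff_ballFloor`, and the record `coreOff_record_g59 : … → CoreOffTubeFloor (63/10) (63/10) (24/5) (1/100) 0`; the merged two-piece form
  (X3b-M) `MemberLaw` (members exchange only with members, floor `δ(z,c,j)`) + `FloorLaw` with `ballFloor_of_member_of_floor`, and `memberLaw_of_site_of_rim`.
* SEQUEL `…FluxLocalRules` (lens content + candidates): the RANGE CUT of (X3b-S) into a fluxed BASE-RANGE law on the finite `R_b`-motif and an un-fluxed
  TAPER-REGIME floor on `(R_b, 9/2]` (`xRec = xBase R_b + xTail R_b`, proved; `siteLaw_of_base_of_tail`); the rule interface `HasRange` / `FluxBound`;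
  the CANDIDATE rules (definitions + antisymmetry only, NO law claimed) — BOND-SHARE `shareFlux w ν W` (re-book each bond's energy between its ends in
  proportions `w j k + w k j = 1`; the format of `…LocalPricing.interactionEnergy_eq_sum_shares`) and EQUALISING `lapFlux λ` (`λ(r_jk)·(s_k − s_j)`); order lemmas.
  Which rule, with which class table and floors, is the census question (O8′) = (O8) re-posed in this currency (memo NODE-g59 §3).
WHY EACH PIECE IS STRICTLY WEAKER / NOT THE TARGET: (X3b-R) and (X3b-C) hold for the ZERO rule with `β = 0` and are geometric; (X3b-S) for a FIXED finite-range
rule is a statement about single-site motifs (radius `max(range W, 9/5) + L`), neither implied by nor implying [CORE-FAR] (it is asked only on members of far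
balls but per site; MustFail MF-1/2); the three together imply it (junction) and the existential relaxation of (S)+(R)+(C) is exactly equivalent to it
(`ballFloor_iff_exists_memberFlux`) — so the cut loses nothing and gains exactly the rule restriction.  WHY NOVEL (relative to the line's record): 50E–58G
price a far cluster against a HOST (chart + envelope modulus + certificate over a host family; dead at certification by OUTER30's −55…−379 % duals); here no
host exists — the certificate is per SITE CLASS, the only global object is the telescoping identity, and the profile is demoted to a classifier.
Lean fixes no census number; tree import `…StrainBands` only; no sorry, no new axioms, no cite tokens, no instances / notation / macros.  (400-line rule, critic
ROW 900: THIS FILE = §§1–2, kernel + pieces + junctions + per-class pieces; the sequel `…FluxLocalRules` = interface, range cut, candidates, order.)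
-/

noncomputable section

namespace Summit.AtomisticToContinuum.Crystallization.Theorems.FrustratedLawDichotomyStrainedPatchFluxLocal

open scoped BigOperators Classical
open Summit.AtomisticToContinuum.Crystallization.Theorems.FrustratedLawDichotomyMotifLemmas
open Summit.AtomisticToContinuum.Crystallization.Theorems.FrustratedLawDichotomyAveragingCut
open Summit.AtomisticToContinuum.Crystallization.Theorems.FrustratedLawDichotomyAveragingRuleCap
open Summit.AtomisticToContinuum.Crystallization.Theorems.FrustratedLawDichotomyAveragingRuleTightFree
open Summit.AtomisticToContinuum.Crystallization.Theorems.FrustratedLawDichotomyStrainedPatchHomSplit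
open Summit.AtomisticToContinuum.Crystallization.Theorems.FrustratedLawDichotomyStrainedPatchCleanCollar
open Summit.AtomisticToContinuum.Crystallization.Theorems.FrustratedLawDichotomyStrainedPatchPhaseCut
open Summit.AtomisticToContinuum.Crystallization.Theorems.FrustratedLawDichotomyStrainedPatchCoreTube
open Summit.AtomisticToContinuum.Crystallization.Theorems.FrustratedLawDichotomyStrainedPatchStrainBands

/-! ## §1. The kernel on one cluster: shares, divergence, telescoping, and the costume certificate -/

/-- **`share z x j = x_j / #ball (9/5) z j`** — site `j`'s SENT SHARE, the summand of the sender-normalised ball average. [definition] -/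
def share {M : ℕ} (z : Fin M → E3) (x : Fin M → ℝ) (j : Fin M) : ℝ :=
  x j / ((ball (9 / 5) z j).card : ℝ)

/-- The score is the sum of the members' shares (definitional). [formal bookkeeping] -/
theorem ballAvg_eq_sum_share {M : ℕ} (z : Fin M → E3) (x : Fin M → ℝ) (c : Fin M) :
    ballAvg (9 / 5) z x c = ∑ j ∈ ball (9 / 5) z c, share z x j := rfl

/-- **`fluxDiv f j = Σ_k f j k`** — net INFLOW at `j` of a pair flux `f` («`f j k` = what `j` receives from `k`»). [definition] -/
def fluxDiv {M : ℕ} (f : Fin M → Fin M → ℝ) (j : Fin M) : ℝ := ∑ k, f j k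

/-- Antisymmetry of a pair flux on one cluster. [definition] -/
def IsAntisym {M : ℕ} (f : Fin M → Fin M → ℝ) : Prop := ∀ j k, f j k = -f k j

/-- ★ TELESCOPING I: an antisymmetric flux exchanges nothing INSIDE any site set. [folklore] -/
theorem sum_sum_eq_zero_of_antisym {M : ℕ} {f : Fin M → Fin M → ℝ} (hf : IsAntisym f) (B : Finset (Fin M)) :
    ∑ j ∈ B, ∑ k ∈ B, f j k = 0 := by
  have h1 : ∑ j ∈ B, ∑ k ∈ B, f j k = ∑ j ∈ B, ∑ k ∈ B, f k j := Finset.sum_comm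
  have h2 : ∑ j ∈ B, ∑ k ∈ B, f k j = -∑ j ∈ B, ∑ k ∈ B, f j k := by
    rw [← Finset.sum_neg_distrib]
    refine Finset.sum_congr rfl fun j _ => ?_
    rw [← Finset.sum_neg_distrib]
    exact Finset.sum_congr rfl fun k _ => by rw [hf k j]
  linarith

/-- ★ TELESCOPING II: summed over a site set, the net inflows reduce to the RIM exchange (bonds with one end outside). [folklore] -/
theorem sum_fluxDiv_eq_rim {M : ℕ} {f : Fin M → Fin M → ℝ} (hf : IsAntisym f) (B : Finset (Fin M)) :
    ∑ j ∈ B, fluxDiv f j = ∑ j ∈ B, ∑ k ∈ Bᶜ, f j k := by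
  have h : ∀ j, fluxDiv f j = ∑ k ∈ B, f j k + ∑ k ∈ Bᶜ, f j k := fun j => (Finset.sum_add_sum_compl B (f j)).symm
  simp_rw [h, Finset.sum_add_distrib, sum_sum_eq_zero_of_antisym hf B, zero_add]

/-- ★ ONE-CLUSTER JUNCTION (site floor + rim bound): if every member clears `γ_j` after the net inflow of an antisymmetric flux and the rim exchange is at most
`Σ_B γ − φ`, then `φ ≤ S`. [folklore] -/
theorem floor_of_site_of_rim_one {M : ℕ} {z : Fin M → E3} {x : Fin M → ℝ} {c : Fin M} {f : Fin M → Fin M → ℝ} {γ : Fin M → ℝ} {φ : ℝ}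
    (hf : IsAntisym f) (hloc : ∀ j ∈ ball (9 / 5) z c, γ j ≤ share z x j + fluxDiv f j)
    (hrim : ∑ j ∈ ball (9 / 5) z c, ∑ k ∈ (ball (9 / 5) z c)ᶜ, f j k ≤ ∑ j ∈ ball (9 / 5) z c, γ j - φ) :
    φ ≤ ballAvg (9 / 5) z x c := by
  have h1 : ∑ j ∈ ball (9 / 5) z c, γ j ≤ ∑ j ∈ ball (9 / 5) z c, (share z x j + fluxDiv f j) := Finset.sum_le_sum hloc
  rw [Finset.sum_add_distrib, sum_fluxDiv_eq_rim hf] at h1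
  rw [ballAvg_eq_sum_share]
  linarith

/-- ★ ONE-CLUSTER JUNCTION (members only): if every member clears `δ_j` after exchanging with MEMBERS only, then `Σ_B δ ≤ S`. [folklore] -/
theorem floor_of_member_one {M : ℕ} {z : Fin M → E3} {x : Fin M → ℝ} {c : Fin M} {f : Fin M → Fin M → ℝ} {δ : Fin M → ℝ}
    (hf : IsAntisym f) (hmem : ∀ j ∈ ball (9 / 5) z c, δ j ≤ share z x j + ∑ k ∈ ball (9 / 5) z c, f j k) :
    ∑ j ∈ ball (9 / 5) z c, δ j ≤ ballAvg (9 / 5) z x c := by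
  have h1 := Finset.sum_le_sum hmem
  rw [Finset.sum_add_distrib, sum_sum_eq_zero_of_antisym hf, add_zero] at h1
  rwa [ballAvg_eq_sum_share]

/-- ★★ COSTUME CERTIFICATE: for ONE cluster, «some antisymmetric member-to-member transfers make every member clear `δ_j`» is EQUIVALENT to `Σ_B δ ≤ S`
(the equalising transfer `f j k = ((s_k − δ_k) − (s_j − δ_j)) / #B`).  Cluster-dependent fluxes carry no content; a RULE does. [folklore] -/
theorem exists_antisym_member_iff {M : ℕ} (z : Fin M → E3) (x : Fin M → ℝ) (c : Fin M) (δ : Fin M → ℝ) :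
    (∃ f : Fin M → Fin M → ℝ, IsAntisym f ∧ ∀ j ∈ ball (9 / 5) z c, δ j ≤ share z x j + ∑ k ∈ ball (9 / 5) z c, f j k) ↔
      ∑ j ∈ ball (9 / 5) z c, δ j ≤ ballAvg (9 / 5) z x c := by
  constructor
  · rintro ⟨f, hf, hmem⟩
    exact floor_of_member_one hf hmem
  · intro h
    set B := ball (9 / 5) z c with hB
    have hn : (0 : ℝ) < B.card := card_ball_pos (by norm_num) z c
    refine ⟨fun j k => ((share z x k - δ k) - (share z x j - δ j)) / B.card, fun j k => by ring, fun j _ => ?_⟩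
    have hS : ∑ k ∈ B, δ k ≤ ∑ k ∈ B, share z x k := by rwa [ballAvg_eq_sum_share] at h
    have key : ∑ k ∈ B, ((share z x k - δ k) - (share z x j - δ j)) / (B.card : ℝ)
        = (∑ k ∈ B, (share z x k - δ k)) / (B.card : ℝ) - (share z x j - δ j) := by
      rw [← Finset.sum_div, Finset.sum_sub_distrib, Finset.sum_const, nsmul_eq_mul, sub_div, mul_div_cancel_left₀ _ hn.ne']
    rw [key]
    have h0 : 0 ≤ (∑ k ∈ B, (share z x k - δ k)) / (B.card : ℝ) :=
      div_nonneg (by rw [Finset.sum_sub_distrib]; linarith) hn.le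
    linarith

/-! ## §2. The pieces: cluster classes, ONE flux rule for all clusters, site / rim / count laws, junctions, per-class CERT pieces -/

/-- **`BallFloor H φ`** — the TARGET SHAPE: every cluster of class `H` scores `≥ φ`. -/
def BallFloor (H : (M : ℕ) → (Fin M → E3) → Fin M → Prop) (φ : ℝ) : Prop :=
  ∀ (M : ℕ) (z : Fin M → E3) (c : Fin M), H M z c → φ ≤ ballAvg (9 / 5) z (xRec M z) c

/-- **`FarClass r r₁ ρ ε`** — the clusters of [CORE-FAR]: admissible, `r`-clean, `r₁`-mono-phase, NOT `(ρ, ε)`-near a homogeneous isometric instance. -/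
def FarClass (r r₁ ρ ε : ℝ) : (M : ℕ) → (Fin M → E3) → Fin M → Prop := fun M z c =>
  Admissible M z c ∧ CleanBall r z c ∧ MonoPhaseBall r₁ z c ∧ ¬NearHomIsoAt ρ ε z c

/-- [CORE-FAR] IS the ball floor of the far class (currying). [formal bookkeeping] -/
theorem coreOffTubeFloor_iff_ballFloor (r r₁ ρ ε φ : ℝ) : CoreOffTubeFloor r r₁ ρ ε φ ↔ BallFloor (FarClass r r₁ ρ ε) φ :=
  ⟨fun h M z c hH => h M z c hH.1 hH.2.1 hH.2.2.1 hH.2.2.2, fun h M z c hz hcl hm hn => h M z c ⟨hz, hcl, hm, hn⟩⟩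

/-- The edge / band / soft sub-classes of g50's strain-band cut (centre misfit below `η₁` / in `[η₁, η₂)` / at least `η₂`). -/
def EdgeClass (r r₁ ρ ε η₁ : ℝ) : (M : ℕ) → (Fin M → E3) → Fin M → Prop := fun M z c =>
  FarClass r r₁ ρ ε M z c ∧ GoodAtScale η₁ (3 / 2) z c

/-- (see `EdgeClass`) -/
def BandClass (r r₁ ρ ε η₁ η₂ : ℝ) : (M : ℕ) → (Fin M → E3) → Fin M → Prop := fun M z c =>
  FarClass r r₁ ρ ε M z c ∧ ¬GoodAtScale η₁ (3 / 2) z c ∧ GoodAtScale η₂ (3 / 2) z c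

/-- (see `EdgeClass`) -/
def SoftClass (r r₁ ρ ε η₂ : ℝ) : (M : ℕ) → (Fin M → E3) → Fin M → Prop := fun M z c =>
  FarClass r r₁ ρ ε M z c ∧ ¬GoodAtScale η₂ (3 / 2) z c

/-- `edgeFarFloor_iff_ballFloor` (docstring added by the landing lane; see the module docstring). [formal bookkeeping] -/
theorem edgeFarFloor_iff_ballFloor (r r₁ ρ ε η₁ φ : ℝ) : EdgeFarFloor r r₁ ρ ε η₁ φ ↔ BallFloor (EdgeClass r r₁ ρ ε η₁) φ :=
  ⟨fun h M z c hH => h M z c hH.1.1 hH.1.2.1 hH.1.2.2.1 hH.1.2.2.2 hH.2, fun h M z c hz hcl hm hn hg => h M z c ⟨⟨hz, hcl, hm, hn⟩, hg⟩⟩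

/-- `bandFarFloor_iff_ballFloor` (docstring added by the landing lane; see the module docstring). [formal bookkeeping] -/
theorem bandFarFloor_iff_ballFloor (r r₁ ρ ε η₁ η₂ φ : ℝ) : BandFarFloor r r₁ ρ ε η₁ η₂ φ ↔ BallFloor (BandClass r r₁ ρ ε η₁ η₂) φ :=
  ⟨fun h M z c hH => h M z c hH.1.1 hH.1.2.1 hH.1.2.2.1 hH.1.2.2.2 hH.2.1 hH.2.2,
    fun h M z c hz hcl hm hn hg₁ hg₂ => h M z c ⟨⟨hz, hcl, hm, hn⟩, hg₁, hg₂⟩⟩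

/-- `softFarFloor_iff_ballFloor` (docstring added by the landing lane; see the module docstring). [formal bookkeeping] -/
theorem softFarFloor_iff_ballFloor (r r₁ ρ ε η₂ φ : ℝ) : SoftFarFloor r r₁ ρ ε η₂ φ ↔ BallFloor (SoftClass r r₁ ρ ε η₂) φ :=
  ⟨fun h M z c hH => h M z c hH.1.1 hH.1.2.1 hH.1.2.2.1 hH.1.2.2.2 hH.2, fun h M z c hz hcl hm hn hg => h M z c ⟨⟨hz, hcl, hm, hn⟩, hg⟩⟩

/-- **`RuleAntisym F`** [STRUCTURAL, decidable for a concrete rule] — the flux RULE is antisymmetric on every cluster. -/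
def RuleAntisym (F : (M : ℕ) → (Fin M → E3) → Fin M → Fin M → ℝ) : Prop := ∀ (M : ℕ) (z : Fin M → E3), IsAntisym (F M z)

/-- **(X3b-S) `SiteLaw H F γ` [ANALYTIC per site class · UNDECIDED · INSTRUMENTABLE by (O8′)]** — every `9/5`-member `j` of an `H`-cluster clears its floor
after the rule's net inflow: `γ(z, j) ≤ s_j + Σ_k F z j k`.  The floor reads the site only (no centre, no host). -/
def SiteLaw (H : (M : ℕ) → (Fin M → E3) → Fin M → Prop) (F : (M : ℕ) → (Fin M → E3) → Fin M → Fin M → ℝ)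
    (γ : (M : ℕ) → (Fin M → E3) → Fin M → ℝ) : Prop :=
  ∀ (M : ℕ) (z : Fin M → E3) (c : Fin M), H M z c → ∀ j ∈ ball (9 / 5) z c, γ M z j ≤ share z (xRec M z) j + fluxDiv (F M z) j

/-- **(X3b-R) `RimLaw H F β` [GEOMETRIC-ANALYTIC · WEAKER · INSTRUMENTABLE]** — a member's exchange with NON-members of the ball is at most its rim
allowance `β(z, c, j)`. -/
def RimLaw (H : (M : ℕ) → (Fin M → E3) → Fin M → Prop) (F : (M : ℕ) → (Fin M → E3) → Fin M → Fin M → ℝ)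
    (β : (M : ℕ) → (Fin M → E3) → Fin M → Fin M → ℝ) : Prop :=
  ∀ (M : ℕ) (z : Fin M → E3) (c : Fin M), H M z c → ∀ j ∈ ball (9 / 5) z c, ∑ k ∈ (ball (9 / 5) z c)ᶜ, F M z j k ≤ β M z c j

/-- **(X3b-C) `CountLaw H γ β φ` [COMBINATORIAL · WEAKER · DECIDABLE per cluster]** — on every `H`-ball the floors beat the rim allowances by `φ`. -/
def CountLaw (H : (M : ℕ) → (Fin M → E3) → Fin M → Prop) (γ : (M : ℕ) → (Fin M → E3) → Fin M → ℝ)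
    (β : (M : ℕ) → (Fin M → E3) → Fin M → Fin M → ℝ) (φ : ℝ) : Prop :=
  ∀ (M : ℕ) (z : Fin M → E3) (c : Fin M), H M z c → φ ≤ ∑ j ∈ ball (9 / 5) z c, (γ M z j - β M z c j)

/-- **(X3b-M) `MemberLaw H F δ`** — the merged form: every member clears `δ(z, c, j)` after exchanging with MEMBERS only. -/
def MemberLaw (H : (M : ℕ) → (Fin M → E3) → Fin M → Prop) (F : (M : ℕ) → (Fin M → E3) → Fin M → Fin M → ℝ)
    (δ : (M : ℕ) → (Fin M → E3) → Fin M → Fin M → ℝ) : Prop :=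
  ∀ (M : ℕ) (z : Fin M → E3) (c : Fin M), H M z c →
    ∀ j ∈ ball (9 / 5) z c, δ M z c j ≤ share z (xRec M z) j + ∑ k ∈ ball (9 / 5) z c, F M z j k

/-- **`FloorLaw H δ φ` [COMBINATORIAL]** — the merged floors sum to at least `φ` on every `H`-ball. -/
def FloorLaw (H : (M : ℕ) → (Fin M → E3) → Fin M → Prop) (δ : (M : ℕ) → (Fin M → E3) → Fin M → Fin M → ℝ) (φ : ℝ) : Prop :=
  ∀ (M : ℕ) (z : Fin M → E3) (c : Fin M), H M z c → φ ≤ ∑ j ∈ ball (9 / 5) z c, δ M z c j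

/-- ★★ JUNCTION (merged form): antisymmetric rule ∧ (X3b-M) ∧ floor count ⟹ the ball floor.  Every class, rule, floor. [folklore] -/
theorem ballFloor_of_member_of_floor {H : (M : ℕ) → (Fin M → E3) → Fin M → Prop} {F : (M : ℕ) → (Fin M → E3) → Fin M → Fin M → ℝ}
    {δ : (M : ℕ) → (Fin M → E3) → Fin M → Fin M → ℝ} {φ : ℝ} (hA : RuleAntisym F) (hM : MemberLaw H F δ) (hΦ : FloorLaw H δ φ) :
    BallFloor H φ := fun M z c hH =>
  (hΦ M z c hH).trans (floor_of_member_one (δ := fun j => δ M z c j) (hA M z) (hM M z c hH))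

/-- ★ site law ∧ rim law ⟹ merged member law with floor `γ − β`. [folklore] -/
theorem memberLaw_of_site_of_rim {H : (M : ℕ) → (Fin M → E3) → Fin M → Prop} {F : (M : ℕ) → (Fin M → E3) → Fin M → Fin M → ℝ}
    {γ : (M : ℕ) → (Fin M → E3) → Fin M → ℝ} {β : (M : ℕ) → (Fin M → E3) → Fin M → Fin M → ℝ} (hS : SiteLaw H F γ) (hR : RimLaw H F β) :
    MemberLaw H F (fun M z c j => γ M z j - β M z c j) := by
  intro M z c hH j hj
  have h1 := hS M z c hH j hj
  have h2 := hR M z c hH j hj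
  have h3 : fluxDiv (F M z) j = ∑ k ∈ ball (9 / 5) z c, F M z j k + ∑ k ∈ (ball (9 / 5) z c)ᶜ, F M z j k :=
    (Finset.sum_add_sum_compl _ _).symm
  simp only
  linarith

/-- ★ count law ⟹ floor law of the merged floor. [formal bookkeeping] -/
theorem floorLaw_of_count {H : (M : ℕ) → (Fin M → E3) → Fin M → Prop} {γ : (M : ℕ) → (Fin M → E3) → Fin M → ℝ}
    {β : (M : ℕ) → (Fin M → E3) → Fin M → Fin M → ℝ} {φ : ℝ} (hC : CountLaw H γ β φ) :
    FloorLaw H (fun M z c j => γ M z j - β M z c j) φ := hC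

/-- ★★★ JUNCTION (three-piece form): antisymmetric rule ∧ (X3b-S) ∧ (X3b-R) ∧ (X3b-C) ⟹ the ball floor. [folklore] -/
theorem ballFloor_of_site_of_rim_of_count {H : (M : ℕ) → (Fin M → E3) → Fin M → Prop} {F : (M : ℕ) → (Fin M → E3) → Fin M → Fin M → ℝ}
    {γ : (M : ℕ) → (Fin M → E3) → Fin M → ℝ} {β : (M : ℕ) → (Fin M → E3) → Fin M → Fin M → ℝ} {φ : ℝ}
    (hA : RuleAntisym F) (hS : SiteLaw H F γ) (hR : RimLaw H F β) (hC : CountLaw H γ β φ) : BallFloor H φ :=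
  ballFloor_of_member_of_floor hA (memberLaw_of_site_of_rim hS hR) (floorLaw_of_count hC)

/-- ★★★ THE RECORD: (X3b-S) ∧ (X3b-R) ∧ (X3b-C) on the far class of record ⟹ `CoreOffTubeFloor (63/10) (63/10) (24/5) (1/100) 0` [CORE-FAR]. [folklore] -/
theorem coreOff_record_g59 {F : (M : ℕ) → (Fin M → E3) → Fin M → Fin M → ℝ} {γ : (M : ℕ) → (Fin M → E3) → Fin M → ℝ}
    {β : (M : ℕ) → (Fin M → E3) → Fin M → Fin M → ℝ} (hA : RuleAntisym F) (hS : SiteLaw (FarClass (63 / 10) (63 / 10) (24 / 5) (1 / 100)) F γ)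
    (hR : RimLaw (FarClass (63 / 10) (63 / 10) (24 / 5) (1 / 100)) F β) (hC : CountLaw (FarClass (63 / 10) (63 / 10) (24 / 5) (1 / 100)) γ β 0) :
    CoreOffTubeFloor (63 / 10) (63 / 10) (24 / 5) (1 / 100) 0 :=
  (coreOffTubeFloor_iff_ballFloor _ _ _ _ _).2 (ballFloor_of_site_of_rim_of_count hA hS hR hC)

/-- … and under g50/g58's band cut: the three pieces on the EDGE class give `EdgeFarFloor`, to be met with [BAND]/[SOFT-FAR] of record. [folklore] -/
theorem edgeFar_of_site_of_rim_of_count {r r₁ ρ ε η₁ φ : ℝ} {F : (M : ℕ) → (Fin M → E3) → Fin M → Fin M → ℝ}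
    {γ : (M : ℕ) → (Fin M → E3) → Fin M → ℝ} {β : (M : ℕ) → (Fin M → E3) → Fin M → Fin M → ℝ} (hA : RuleAntisym F)
    (hS : SiteLaw (EdgeClass r r₁ ρ ε η₁) F γ) (hR : RimLaw (EdgeClass r r₁ ρ ε η₁) F β) (hC : CountLaw (EdgeClass r r₁ ρ ε η₁) γ β φ) :
    EdgeFarFloor r r₁ ρ ε η₁ φ :=
  (edgeFarFloor_iff_ballFloor _ _ _ _ _ _).2 (ballFloor_of_site_of_rim_of_count hA hS hR hC)

/-- ★★ NOTHING IS LOST: the ball floor is EQUIVALENT to the existence, cluster by cluster, of antisymmetric member transfers after which every member clears the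
flat floor `φ / #B` — the existential relaxation of (X3b) is [CORE-FAR] itself; the rule restriction is the whole content. [folklore] -/
theorem ballFloor_iff_exists_memberFlux (H : (M : ℕ) → (Fin M → E3) → Fin M → Prop) (φ : ℝ) :
    BallFloor H φ ↔ ∀ (M : ℕ) (z : Fin M → E3) (c : Fin M), H M z c → ∃ f : Fin M → Fin M → ℝ, IsAntisym f ∧
      ∀ j ∈ ball (9 / 5) z c, φ / (ball (9 / 5) z c).card ≤ share z (xRec M z) j + ∑ k ∈ ball (9 / 5) z c, f j k := by
  have hsum : ∀ (M : ℕ) (z : Fin M → E3) (c : Fin M), ∑ j ∈ ball (9 / 5) z c, φ / ((ball (9 / 5) z c).card : ℝ) = φ := fun M z c => by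
    rw [Finset.sum_const, nsmul_eq_mul, mul_div_cancel₀ _ (card_ball_pos (by norm_num) z c).ne']
  constructor
  · intro h M z c hH
    exact (exists_antisym_member_iff z (xRec M z) c fun _ => φ / ((ball (9 / 5) z c).card : ℝ)).2 (by rw [hsum]; exact h M z c hH)
  · intro h M z c hH
    have := (exists_antisym_member_iff z (xRec M z) c fun _ => φ / ((ball (9 / 5) z c).card : ℝ)).1 (h M z c hH)
    rwa [hsum] at this

/-! ### Order structure (the trade: lower floors ease (S) and load (C); larger allowances ease (R) and load (C); every law antitone in the class) -/

/-- `SiteLaw.anti` (docstring added by the landing lane; see the module docstring). [formal bookkeeping] -/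
theorem SiteLaw.anti {H : (M : ℕ) → (Fin M → E3) → Fin M → Prop} {F : (M : ℕ) → (Fin M → E3) → Fin M → Fin M → ℝ}
    {γ γ' : (M : ℕ) → (Fin M → E3) → Fin M → ℝ} (h : SiteLaw H F γ) (hle : ∀ (M : ℕ) (z : Fin M → E3) (j : Fin M), γ' M z j ≤ γ M z j) :
    SiteLaw H F γ' := fun M z c hH j hj => (hle M z j).trans (h M z c hH j hj)

/-- `RimLaw.mono` (docstring added by the landing lane; see the module docstring). [formal bookkeeping] -/
theorem RimLaw.mono {H : (M : ℕ) → (Fin M → E3) → Fin M → Prop} {F : (M : ℕ) → (Fin M → E3) → Fin M → Fin M → ℝ}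
    {β β' : (M : ℕ) → (Fin M → E3) → Fin M → Fin M → ℝ} (h : RimLaw H F β) (hle : ∀ (M : ℕ) (z : Fin M → E3) (c j : Fin M), β M z c j ≤ β' M z c j) :
    RimLaw H F β' := fun M z c hH j hj => (h M z c hH j hj).trans (hle M z c j)

/-- `CountLaw.of_le` (docstring added by the landing lane; see the module docstring). [formal bookkeeping] -/
theorem CountLaw.of_le {H : (M : ℕ) → (Fin M → E3) → Fin M → Prop} {γ : (M : ℕ) → (Fin M → E3) → Fin M → ℝ}
    {β : (M : ℕ) → (Fin M → E3) → Fin M → Fin M → ℝ} {φ φ' : ℝ} (h : CountLaw H γ β φ) (hle : φ' ≤ φ) : CountLaw H γ β φ' :=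
  fun M z c hH => hle.trans (h M z c hH)

/-- `BallFloor.of_le` (docstring added by the landing lane; see the module docstring). [formal bookkeeping] -/
theorem BallFloor.of_le {H : (M : ℕ) → (Fin M → E3) → Fin M → Prop} {φ φ' : ℝ} (h : BallFloor H φ) (hle : φ' ≤ φ) : BallFloor H φ' :=
  fun M z c hH => hle.trans (h M z c hH)

/-- The laws are ANTITONE in the cluster class (a smaller class is easier to serve). [formal bookkeeping] -/
theorem SiteLaw.of_imp {H H' : (M : ℕ) → (Fin M → E3) → Fin M → Prop} {F : (M : ℕ) → (Fin M → E3) → Fin M → Fin M → ℝ}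
    {γ : (M : ℕ) → (Fin M → E3) → Fin M → ℝ} (h : SiteLaw H F γ) (himp : ∀ (M : ℕ) (z : Fin M → E3) (c : Fin M), H' M z c → H M z c) :
    SiteLaw H' F γ := fun M z c hH => h M z c (himp M z c hH)

/-- `BallFloor.of_imp` (docstring added by the landing lane; see the module docstring). [formal bookkeeping] -/
theorem BallFloor.of_imp {H H' : (M : ℕ) → (Fin M → E3) → Fin M → Prop} {φ : ℝ} (h : BallFloor H φ)
    (himp : ∀ (M : ℕ) (z : Fin M → E3) (c : Fin M), H' M z c → H M z c) : BallFloor H' φ := fun M z c hH => h M z c (himp M z c hH)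

/-! ### Per-class CERT pieces: the laws ARE conjunctions over site classes; the count law is a class-histogram constraint -/

/-- **`ClassSiteLaw H F κ g a` [one CERT piece per class `a`]** — (X3b-S) asked only of members of class `κ(z, j) = a`, floor `g a`. -/
def ClassSiteLaw {α : Type*} (H : (M : ℕ) → (Fin M → E3) → Fin M → Prop) (F : (M : ℕ) → (Fin M → E3) → Fin M → Fin M → ℝ)
    (κ : (M : ℕ) → (Fin M → E3) → Fin M → α) (g : α → ℝ) (a : α) : Prop :=
  ∀ (M : ℕ) (z : Fin M → E3) (c : Fin M), H M z c → ∀ j ∈ ball (9 / 5) z c, κ M z j = a → g a ≤ share z (xRec M z) j + fluxDiv (F M z) j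

/-- ★ (X3b-S) with classed floors `γ = g ∘ κ` IS the conjunction of the per-class laws. [formal bookkeeping] -/
theorem siteLaw_iff_classLaws {α : Type*} (H : (M : ℕ) → (Fin M → E3) → Fin M → Prop) (F : (M : ℕ) → (Fin M → E3) → Fin M → Fin M → ℝ)
    (κ : (M : ℕ) → (Fin M → E3) → Fin M → α) (g : α → ℝ) :
    SiteLaw H F (fun M z j => g (κ M z j)) ↔ ∀ a, ClassSiteLaw H F κ g a :=
  ⟨fun h _ M z c hH j hj hκ => hκ ▸ h M z c hH j hj, fun h M z c hH j hj => h (κ M z j) M z c hH j hj rfl⟩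

/-- **`ClassRimLaw H F κ b a`** — (X3b-R) asked only of members of class `a`, allowance `b a`. -/
def ClassRimLaw {α : Type*} (H : (M : ℕ) → (Fin M → E3) → Fin M → Prop) (F : (M : ℕ) → (Fin M → E3) → Fin M → Fin M → ℝ)
    (κ : (M : ℕ) → (Fin M → E3) → Fin M → α) (b : α → ℝ) (a : α) : Prop :=
  ∀ (M : ℕ) (z : Fin M → E3) (c : Fin M), H M z c → ∀ j ∈ ball (9 / 5) z c, κ M z j = a → ∑ k ∈ (ball (9 / 5) z c)ᶜ, F M z j k ≤ b a

/-- `rimLaw_iff_classLaws` (docstring added by the landing lane; see the module docstring). [formal bookkeeping] -/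
theorem rimLaw_iff_classLaws {α : Type*} (H : (M : ℕ) → (Fin M → E3) → Fin M → Prop) (F : (M : ℕ) → (Fin M → E3) → Fin M → Fin M → ℝ)
    (κ : (M : ℕ) → (Fin M → E3) → Fin M → α) (b : α → ℝ) :
    RimLaw H F (fun M z _ j => b (κ M z j)) ↔ ∀ a, ClassRimLaw H F κ b a :=
  ⟨fun h _ M z c hH j hj hκ => hκ ▸ h M z c hH j hj, fun h M z c hH j hj => h (κ M z j) M z c hH j hj rfl⟩

/-- **`MotifCharted 𝓘 τ R z j`** — site `j`'s `R`-motif is `τ`-GRADED-CHARTED by SOME instance of a family `𝓘`: an instance `(M₀, z₀, c₀)` and a labelling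
`e` with `e j = c₀`, relative deviation `dist (z a − z j) (z₀ (e a) − z₀ c₀) ≤ τ (dist (z a) (z j))` on the motif, `e` injective on the motif.  HOST-FREE:
the lattice instance is quantified INSIDE the predicate, site by site — the only door through which a tolerance profile enters (X3b) is a classifier built from it. -/
def MotifCharted (𝓘 : (M₀ : ℕ) → (Fin M₀ → E3) → Fin M₀ → Prop) (τ : ℝ → ℝ) (R : ℝ) {M : ℕ} (z : Fin M → E3) (j : Fin M) : Prop :=
  ∃ (M₀ : ℕ) (z₀ : Fin M₀ → E3) (c₀ : Fin M₀) (e : Fin M → Fin M₀), 𝓘 M₀ z₀ c₀ ∧ e j = c₀ ∧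
    (∀ a, dist (z a) (z j) ≤ R → dist (z a - z j) (z₀ (e a) - z₀ c₀) ≤ τ (dist (z a) (z j))) ∧
    (∀ a b, dist (z a) (z j) ≤ R → dist (z b) (z j) ≤ R → e a = e b → a = b)

/-- Chartedness is MONOTONE in the profile (a looser profile charts more motifs). [folklore] -/
theorem MotifCharted.mono {𝓘 : (M₀ : ℕ) → (Fin M₀ → E3) → Fin M₀ → Prop} {τ τ' : ℝ → ℝ} {R : ℝ} {M : ℕ} {z : Fin M → E3} {j : Fin M}
    (h : MotifCharted 𝓘 τ R z j) (hle : ∀ r, τ r ≤ τ' r) : MotifCharted 𝓘 τ' R z j := by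
  obtain ⟨M₀, z₀, c₀, e, hI, hc, hdev, hinj⟩ := h
  exact ⟨M₀, z₀, c₀, e, hI, hc, fun a ha => (hdev a ha).trans (hle _), hinj⟩

/-- **`chartClass 𝓘 τ R`** — the two-class classifier «is the `R`-motif `τ`-charted by the family?» (the graded profile DEMOTED to a classifier; finer class
tables refine it by strain band / shell census, memo §3). -/
def chartClass (𝓘 : (M₀ : ℕ) → (Fin M₀ → E3) → Fin M₀ → Prop) (τ : ℝ → ℝ) (R : ℝ) : (M : ℕ) → (Fin M → E3) → Fin M → Bool :=
  fun _ z j => decide (MotifCharted 𝓘 τ R z j)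

/-- (X3b-S) classed by chartedness = the CHARTED-motif law ∧ the ROUGH-motif law (two CERT pieces). [formal bookkeeping] -/
theorem siteLaw_chartClass_iff (H : (M : ℕ) → (Fin M → E3) → Fin M → Prop) (F : (M : ℕ) → (Fin M → E3) → Fin M → Fin M → ℝ)
    (𝓘 : (M₀ : ℕ) → (Fin M₀ → E3) → Fin M₀ → Prop) (τ : ℝ → ℝ) (R : ℝ) (g : Bool → ℝ) :
    SiteLaw H F (fun M z j => g (chartClass 𝓘 τ R M z j)) ↔
      ClassSiteLaw H F (chartClass 𝓘 τ R) g true ∧ ClassSiteLaw H F (chartClass 𝓘 τ R) g false := by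
  rw [siteLaw_iff_classLaws]
  exact ⟨fun h => ⟨h true, h false⟩, fun h a => by cases a <;> [exact h.2; exact h.1]⟩

/-- **`ClassHistogramLaw H κ P` [GEOMETRIC · DECIDABLE per cluster · census]** — the class histogram of every `H`-ball satisfies `P`. -/
def ClassHistogramLaw {α : Type*} (H : (M : ℕ) → (Fin M → E3) → Fin M → Prop) (κ : (M : ℕ) → (Fin M → E3) → Fin M → α)
    (P : (α → ℕ) → Prop) : Prop :=
  ∀ (M : ℕ) (z : Fin M → E3) (c : Fin M), H M z c → P fun a => ((ball (9 / 5) z c).filter fun j => κ M z j = a).card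

/-- Summing a classed quantity over the ball = histogram-weighted sum over classes. [folklore] -/
theorem sum_classed_eq {α : Type*} [Fintype α] {M : ℕ} (B : Finset (Fin M)) (κ : Fin M → α) (q : α → ℝ) :
    ∑ j ∈ B, q (κ j) = ∑ a, ((B.filter fun j => κ j = a).card : ℝ) * q a := by
  rw [← Finset.sum_fiberwise' B κ q]
  refine Finset.sum_congr rfl fun a _ => ?_
  rw [Finset.sum_const, nsmul_eq_mul]

/-- ★ (X3b-C) from a class-histogram constraint and ONE linear inequality in the histogram. [folklore] -/
theorem countLaw_of_histogramLaw {α : Type*} [Fintype α] {H : (M : ℕ) → (Fin M → E3) → Fin M → Prop} {κ : (M : ℕ) → (Fin M → E3) → Fin M → α}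
    {P : (α → ℕ) → Prop} {g b : α → ℝ} {φ : ℝ} (hP : ClassHistogramLaw H κ P) (hlin : ∀ h : α → ℕ, P h → φ ≤ ∑ a, (h a : ℝ) * (g a - b a)) :
    CountLaw H (fun M z j => g (κ M z j)) (fun M z _ j => b (κ M z j)) φ := by
  intro M z c hH
  have := hlin _ (hP M z c hH)
  simpa only [sum_classed_eq (ball (9 / 5) z c) (κ M z) (fun a => g a - b a)] using this

end Summit.AtomisticToContinuum.Crystallization.Theorems.FrustratedLawDichotomyStrainedPatchFluxLocal
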